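import Literature.NumberTheory.Transcendental.SemistableNoSubgroup
import Literature.NumberTheory.Transcendental.BakerLogarithmsConclusion
import HarnessLib

/-!
# The Semistability Theorem for the linear groups `𝔾ₘ^β × 𝔾ₐ^δ`, from Baker's theorem

Topic: `Literature/NumberTheory/Transcendental`. A proofs-only file (theorems only, no
definitions, no named facts) of the unit
`provefact-Literature.NumberTheory.Transcendental.s-efcbe22610` (fact
`Literature.NumberTheory.Transcendental.semistabilityTheorem_std`: Baker–Wüstholz,
*Logarithmic Forms and Diophantine Geometry*, Thm. 6.15, for the explicit group varieties
`M_κ = 𝔾ₘ^β × P_κ`).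

When the elliptic factor is absent (`γ = ∅`, so `P_κ = 𝔾ₐ^δ` and `M_κ = 𝔾ₘ^β × 𝔾ₐ^δ` is a
LINEAR commutative group) the Semistability Theorem is a consequence of Baker's theorem on linear
forms in logarithms (Baker 1975, Thm. 2.1: `1, log α₁, …, log αₙ` are `ℚ̄`-linearly independent
when the `log αᵢ` are `ℚ`-linearly independent), PROVED in the tree
(`BakerLogarithmsConclusion.bakerFin_holds`). We prove:

* `GaGmE.Std.baker_relations` — **the `ℚ̄`-linear relations among `log α₁, …, log α_β` and
  algebraic numbers `s₁, …, s_δ`** are generated by the `ℚ`-linear relations among the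
  logarithms and the `ℚ̄`-linear relations among the `s_e`: if
  `∑ φⱼ log αⱼ + ∑ ψ_e s_e = 0` with `φ, ψ` algebraic then `∑ ψ_e s_e = 0` and `φ` is a
  `ℚ̄`-combination of rational relation vectors of `(log αⱼ)` (Baker 1975, Thms. 2.1–2.2);
* `GaGmE.Std.exists_tangent_le_of_isEmpty` — **the analytic subgroup theorem for
  `𝔾ₘ^β × 𝔾ₐ^δ`** (Baker–Wüstholz Thm. 6.1 in this case): for a `ℚ̄`-rational `𝔟 ⊆ Lie M_κ` and
  `w ∈ 𝔟` with `exp(w)` algebraic, the connected algebraic subgroup `K = H_{(A_w, ℚ^γ, Ξ_w)}`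
  (`A_w` = rational relations of the `w_{yⱼ}`, `Ξ_w` = algebraic relations of the `w_{s_e}`) has
  `w ∈ Lie K ⊆ 𝔟`;
* `semistabilityTheorem_std_of_isEmpty` — **Thm. 6.15 for the `M_κ` with `γ = ∅`, proved
  outright**: the statement of `semistabilityTheorem_std` with the extra hypothesis `[IsEmpty γ]`
  (a proper semistable `𝔟` contains no non-zero algebraic Lie subalgebra,
  `Semistable.finrank_eq_zero_of_le`, so `w = 0 ∈ ker`).

The general case (elliptic factors) is the content of the named fact; see
`SemistabilityStdOfEngine.lean` (reduction to Philippon's zero estimate and the Baker engine).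

## References

* A. Baker, *Transcendental Number Theory*, CUP 1975, Ch. 2, Thms. 2.1, 2.2. [Baker1975]
* A. Baker, G. Wüstholz, *Logarithmic Forms and Diophantine Geometry*, New Math. Monogr. 9, CUP
  2007: Thm. 2.1 (Baker's theorem), Thm. 6.1, §6.7, Thm. 6.15. [BakerWustholz2007]
-/

noncomputable section

open Module Submodule Complex

namespace Literature.NumberTheory.Transcendental

namespace GaGmE

namespace Std

open LiePresentation

/-! ### Baker's theorem as a description of linear relations -/

/-- Rational multiples of logarithms of algebraic numbers are logarithms of algebraic numbers:
`e^{q y}` is algebraic if `e^y` is (`(e^{(a/b) y})^b = (e^y)^a`). [folklore] -/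
theorem isAlgebraic_exp_rat_mul {y : ℂ} (hy : IsAlgebraic ℚ (cexp y)) (q : ℚ) :
    IsAlgebraic ℚ (cexp ((q : ℂ) * y)) := by
  refine IsAlgebraic.of_pow q.den_pos ?_
  have e : cexp ((q : ℂ) * y) ^ q.den = cexp y ^ q.num := by
    rw [← Complex.exp_nat_mul, ← Complex.exp_int_mul]
    congr 1
    have hq : (q : ℂ) * (q.den : ℂ) = (q.num : ℂ) := by
      have := Rat.mul_den_eq_num q
      exact_mod_cast this
    calc (q.den : ℂ) * ((q : ℂ) * y) = ((q : ℂ) * (q.den : ℂ)) * y := by ring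
      _ = (q.num : ℂ) * y := by rw [hq]
  rw [e]
  exact isAlgebraic_zpow hy _

/-- Rational combinations of logarithms of algebraic numbers are logarithms of algebraic numbers.
[folklore] -/
theorem isAlgebraic_exp_sum_rat_mul {β : Type} [Fintype β] {y : β → ℂ}
    (hy : ∀ j, IsAlgebraic ℚ (cexp (y j))) (q : β → ℚ) :
    IsAlgebraic ℚ (cexp (∑ j, (q j : ℂ) * y j)) := by
  classical
  rw [Complex.exp_sum]
  refine Finset.prod_induction _ (fun x => IsAlgebraic ℚ x) (fun a b ha hb => ha.mul hb)
    isAlgebraic_one fun j _ => isAlgebraic_exp_rat_mul (hy j) (q j)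

/-- **Baker's theorem as a description of the `ℚ̄`-linear relations among logarithms and
algebraic numbers** (Baker 1975, Thms. 2.1–2.2): let `e^{y₁}, …, e^{y_β}` and `s₁, …, s_δ` be
algebraic and `φ ∈ ℚ̄^β`, `ψ ∈ ℚ̄^δ` with `∑ φⱼ yⱼ + ∑ ψ_e s_e = 0`. Then `∑ ψ_e s_e = 0`, and `φ`
lies in the `ℚ̄`-span of the rational relation vectors `{q ∈ ℚ^β : ∑ qⱼ yⱼ = 0}`. Proof: write the
`yⱼ` in a `ℚ`-basis `v₁, …, v_m` of their `ℚ`-span (logarithms of algebraic numbers,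
`ℚ`-independent); by Baker `1, v₁, …, v_m` are `ℚ̄`-independent, so the constant term and the
coefficients of the `vᵢ` vanish; the latter say that `φ` solves, over `ℚ̄`, the rational linear
system whose rational solutions are the relation vectors, and solution spaces of rational systems
are spanned by rational solutions (`LiePresentation.isKRational_solSpace`).
[cite: Baker1975, Theorem 2.1] [cite: BakerWustholz2007, Thm. 2.1] -/
theorem baker_relations {β δ : Type} [Fintype β] [Fintype δ] {y : β → ℂ}
    (hy : ∀ j, IsAlgebraic ℚ (cexp (y j))) {s : δ → ℂ} (hs : ∀ e, IsAlgebraic ℚ (s e))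
    {φ : β → Kbar} {ψ : δ → Kbar} (hrel : ∑ j, (φ j : ℂ) * y j + ∑ e, (ψ e : ℂ) * s e = 0) :
    ∑ e, (ψ e : ℂ) * s e = 0 ∧
      φ ∈ span Kbar (ofK ℚ (L := Kbar) '' {q : β → ℚ | ∑ j, (q j : ℂ) * y j = 0}) := by
  classical
  -- the `ℚ`-span `V` of the `yⱼ` and a basis `v` of it
  let Y : (β → ℚ) →ₗ[ℚ] ℂ :=
    { toFun := fun q => ∑ j, (q j : ℂ) * y j
      map_add' := fun a b => by
        simp only [Pi.add_apply, Rat.cast_add, add_mul, Finset.sum_add_distrib]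
      map_smul' := fun c a => by
        simp only [Pi.smul_apply, smul_eq_mul, Rat.cast_mul, RingHom.id_apply, Rat.smul_def,
          Finset.mul_sum, mul_assoc] }
  have hY : ∀ q : β → ℚ, Y q = ∑ j, (q j : ℂ) * y j := fun q => rfl
  set V : Submodule ℚ ℂ := LinearMap.range Y with hV
  haveI : FiniteDimensional ℚ V := LinearMap.finiteDimensional_range Y
  let b := Module.finBasis ℚ V
  set m := Module.finrank ℚ V
  let v : Fin m → ℂ := fun i => (b i : ℂ)
  have hv_indep : LinearIndependent ℚ v := b.linearIndependent.map' V.subtype (Submodule.ker_subtype V)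
  have hv_alg : ∀ i, IsAlgebraic ℚ (cexp (v i)) := by
    intro i
    obtain ⟨q, hq⟩ : (v i) ∈ V := (b i).2
    rw [← hq, hY]
    exact isAlgebraic_exp_sum_rat_mul hy q
  -- Baker: `1, v₁, …, v_m` are `ℚ̄`-linearly independent
  have hB := bakerFin_holds m v hv_alg hv_indep
  -- coordinates of the `yⱼ` in the basis
  have hyV : ∀ j, y j ∈ V := fun j => ⟨Pi.single j 1, by
    rw [hY, Finset.sum_eq_single j (fun x _ hx => by simp [Pi.single_eq_of_ne hx])
      (fun h => absurd (Finset.mem_univ j) h)]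
    simp⟩
  let r : β → Fin m → ℚ := fun j i => b.repr ⟨y j, hyV j⟩ i
  have hy_eq : ∀ j, y j = ∑ i, (r j i : ℂ) * v i := by
    intro j
    have h := congrArg (fun x : V => (x : ℂ)) (b.sum_repr ⟨y j, hyV j⟩)
    simp only [Submodule.coe_sum, Submodule.coe_smul, Rat.smul_def] at h
    exact h.symm
  -- the constant term `c = ∑ ψ_e s_e ∈ ℚ̄`
  have hc_alg : IsAlgebraic ℚ (∑ e, (ψ e : ℂ) * s e) := by
    refine Finset.sum_induction _ (fun x => IsAlgebraic ℚ x) (fun a b ha hb => ha.add hb)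
      isAlgebraic_zero fun e _ => (mem_algebraicClosure_iff.mp (ψ e).2).mul (hs e)
  let c : Kbar := ⟨∑ e, (ψ e : ℂ) * s e, mem_algebraicClosure_iff.mpr hc_alg⟩
  have hc : (c : ℂ) = ∑ e, (ψ e : ℂ) * s e := rfl
  -- the relation as a vanishing `ℚ̄`-combination of `1, v₁, …, v_m`
  let g : Option (Fin m) → Kbar := fun o => o.elim c fun i => ∑ j, φ j * (r j i : Kbar)
  have hcoe : ∀ x : Kbar, ∀ z : ℂ, x • z = (x : ℂ) * z := fun x z => rfl
  have h1 : ∑ i, (g (some i)) • v i = ∑ j, (φ j : ℂ) * y j := by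
    simp only [g, Option.elim_some, hcoe]
    push_cast
    simp only [Finset.sum_mul, hy_eq, Finset.mul_sum]
    rw [Finset.sum_comm]
    exact Finset.sum_congr rfl fun j _ => Finset.sum_congr rfl fun i _ => by ring
  have hsum : ∑ o, g o • (o.elim (1 : ℂ) v) = 0 := by
    rw [Fintype.sum_option]
    simp only [Option.elim_none, Option.elim_some]
    rw [h1, hcoe, mul_one]
    show (c : ℂ) + ∑ j, (φ j : ℂ) * y j = 0
    rw [hc, add_comm]
    exact hrel
  have hg : ∀ o, g o = 0 := Fintype.linearIndependent_iff.mp hB g hsum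
  refine ⟨?_, ?_⟩
  · -- the constant term vanishes
    have := hg none
    simp only [g, Option.elim_none] at this
    rw [← hc, this]; rfl
  · -- `φ` solves the rational system `∑ⱼ r_{ji} φⱼ = 0` (`i = 1..m`), whose rational solutions
    -- are relation vectors
    set R : Set (β → ℚ) := Set.range fun i : Fin m => fun j => r j i with hR
    have hφ : φ ∈ solSpace ℚ (L := Kbar) R := by
      rw [mem_solSpace]
      rintro _ ⟨i, rfl⟩
      have := hg (some i)
      simp only [g, Option.elim_some] at this
      rw [← this]
      unfold pair
      exact Finset.sum_congr rfl fun j _ => by rw [eq_ratCast, mul_comm]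
    have hrat := isKRational_solSpace ℚ (L := Kbar) R
    rw [hrat.eq_span_kPoints (K := ℚ)] at hφ
    refine span_mono (Set.image_mono fun q hq => ?_) hφ
    -- a rational solution `q` is a relation vector
    have hq : ∀ i, ∑ j, r j i * q j = 0 := by
      intro i
      have h := ((mem_solSpace ℚ).mp (show ofK ℚ (L := Kbar) q ∈ solSpace ℚ R from hq)) _ ⟨i, rfl⟩
      rw [pair_ofK] at h
      exact (algebraMap ℚ Kbar).injective (by rw [h, map_zero])
    show ∑ j, (q j : ℂ) * y j = 0
    simp only [hy_eq, Finset.mul_sum]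
    rw [Finset.sum_comm]
    have : ∀ i, ∑ j, (q j : ℂ) * ((r j i : ℂ) * v i) = ((∑ j, r j i * q j : ℚ) : ℂ) * v i := by
      intro i
      push_cast
      rw [Finset.sum_mul]
      exact Finset.sum_congr rfl fun j _ => by ring
    simp only [this, hq, Rat.cast_zero, zero_mul, Finset.sum_const_zero]

/-! ### The analytic subgroup theorem for `𝔾ₘ^β × 𝔾ₐ^δ` -/

variable {β γ δ : Type} [Fintype β] [Fintype γ] [Fintype δ]

/-- **The analytic subgroup theorem for the linear groups `M_κ = 𝔾ₘ^β × 𝔾ₐ^δ` (`γ = ∅`)**, from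
Baker's theorem: for a `ℚ̄`-rational `𝔟 ⊆ Lie M_κ` and `w = (y; s) ∈ 𝔟_ℂ` with `exp(w)`
algebraic (`e^{yⱼ}, s_e ∈ ℚ̄`), the connected algebraic subgroup `K` cut out by the rational
relations of the `yⱼ` (a subtorus) and the algebraic relations of the `s_e` (a vector subgroup)
has `w ∈ Lie K ⊆ 𝔟` — the `ℚ̄`-linear forms vanishing at `w` are, by `baker_relations`, exactly
those vanishing on `Lie K`. [cite: BakerWustholz2007, Thm. 6.1, Thm. 2.1] [cite: Baker1975, Theorem 2.1] -/
theorem exists_tangent_le_of_isEmpty [IsEmpty γ] (L : PeriodPair) (κM : δ → γ → Kbar)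
    {𝔟 : Submodule ℂ (β ⊕ (γ ⊕ δ) → ℂ)} (hrat : IsKRational Kbar 𝔟)
    {w : β ⊕ (γ ⊕ δ) → ℂ} (hw𝔟 : w ∈ 𝔟) (hw : w ∈ Alg L κM) :
    ∃ D : SubgroupData β γ δ κM, w ∈ D.tangent ∧ D.tangent ≤ 𝔟 := by
  classical
  obtain ⟨hy, t', -, hs⟩ := hw
  have hs' : ∀ e, IsAlgebraic ℚ (w (is e)) := fun e => by simpa using hs e
  -- the rational relations of the `yⱼ` and the algebraic relations of the `s_e`
  let Y : (β → ℚ) →ₗ[ℚ] ℂ :=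
    { toFun := fun q => ∑ j, (q j : ℂ) * w (iy j)
      map_add' := fun a b => by
        simp only [Pi.add_apply, Rat.cast_add, add_mul, Finset.sum_add_distrib]
      map_smul' := fun c a => by
        simp only [Pi.smul_apply, smul_eq_mul, Rat.cast_mul, RingHom.id_apply, Rat.smul_def,
          Finset.mul_sum, mul_assoc] }
  have hcoe : ∀ x : Kbar, ∀ z : ℂ, x • z = (x : ℂ) * z := fun x z => rfl
  let Ψ : (δ → Kbar) →ₗ[Kbar] ℂ :=
    { toFun := fun ξ => ∑ e, (ξ e : ℂ) * w (is e)
      map_add' := fun a b => by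
        simp only [Pi.add_apply, AddMemClass.coe_add, add_mul, Finset.sum_add_distrib]
      map_smul' := fun c a => by
        simp only [Pi.smul_apply, smul_eq_mul, MulMemClass.coe_mul, RingHom.id_apply, hcoe,
          Finset.mul_sum, mul_assoc] }
  let D : SubgroupData β γ δ κM :=
    { A := LinearMap.ker Y
      C := ⊤
      Ξ := LinearMap.ker Ψ
      compat := fun ξ _ => by
        rw [Subsingleton.elim (fun b => ∑ e, ξ e * κM e b) 0]
        exact Submodule.zero_mem _ }
  have hA : ∀ q : β → ℚ, q ∈ D.A ↔ ∑ j, (q j : ℂ) * w (iy j) = 0 := fun q => LinearMap.mem_ker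
  have hΞ : ∀ ξ : δ → Kbar, ξ ∈ D.Ξ ↔ ∑ e, (ξ e : ℂ) * w (is e) = 0 := fun ξ => LinearMap.mem_ker
  refine ⟨D, ?_, ?_⟩
  · -- `w ∈ Lie K`
    rw [SubgroupData.mem_tangent_iff]
    exact ⟨fun q hq => (hA q).mp hq, fun c _ => by simp, fun ξ hξ => (hΞ ξ).mp hξ⟩
  · -- `Lie K ⊆ 𝔟`: the `ℚ̄`-forms vanishing on `𝔟` vanish at `w`, hence (Baker) on `Lie K`
    intro v hv
    rw [SubgroupData.mem_tangent_iff] at hv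
    obtain ⟨hvA, -, hvΞ⟩ := hv
    set Θ : Submodule ℂ (β ⊕ (γ ⊕ δ) → ℂ) := dotAnn 𝔟 with hΘ
    have hΘrat : IsKRational Kbar Θ := hrat.dotAnn Kbar
    rw [← dotAnn_dotAnn 𝔟, mem_dotAnn]
    intro θ hθ
    change θ ∈ Θ at hθ
    rw [hΘrat.eq_span_kPoints (K := Kbar)] at hθ
    induction hθ using Submodule.span_induction with
    | mem x hx =>
      obtain ⟨φK, hφK, rfl⟩ := hx
      -- `ofK φK ∈ dotAnn 𝔟` kills `w`
      have hφw' : ∑ x, w x * (ofK Kbar (L := ℂ) φK) x = 0 := (mem_dotAnn.mp hφK) w hw𝔟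
      have hφw : ∑ x, (ofK Kbar (L := ℂ) φK) x * w x = 0 := by
        rw [← hφw']; exact Finset.sum_congr rfl fun x _ => mul_comm _ _
      rw [sum_blocks] at hφw ⊢
      simp only [Finset.univ_eq_empty, Finset.sum_empty, add_zero, ofK_apply] at hφw ⊢
      -- Baker
      obtain ⟨h0, hspan⟩ := baker_relations (φ := fun j => φK (iy j)) (ψ := fun e => φK (is e)) hy hs' hφw
      have h2 : ∑ e, algebraMap Kbar ℂ (φK (is e)) * v (is e) = 0 :=
        hvΞ (fun e => φK (is e)) ((hΞ _).mpr h0)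
      have h1 : ∑ j, algebraMap Kbar ℂ (φK (iy j)) * v (iy j) = 0 := by
        -- by `span_induction` on `hspan`: generators are rational relation vectors, killed by `hvA`
        have key : ∀ φ ∈ span Kbar (ofK ℚ (L := Kbar) '' {q : β → ℚ | ∑ j, (q j : ℂ) * w (iy j) = 0}),
            ∑ j, ((φ j : Kbar) : ℂ) * v (iy j) = 0 := by
          intro φ hφ
          induction hφ using Submodule.span_induction with
          | mem x hx =>
            obtain ⟨q, hq, rfl⟩ := hx
            have := hvA q ((hA q).mpr hq)
            simpa [ofK_apply, eq_ratCast] using this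
          | zero => simp
          | add x y _ _ hx hy =>
            simp only [Pi.add_apply, AddMemClass.coe_add, add_mul, Finset.sum_add_distrib, hx, hy,
              add_zero]
          | smul a x _ hx =>
            simp only [Pi.smul_apply, smul_eq_mul, MulMemClass.coe_mul, mul_assoc, ← Finset.mul_sum,
              hx, mul_zero]
        exact key _ hspan
      rw [h1, h2, add_zero]
    | zero => simp
    | add x y _ _ hx hy =>
      simp only [Pi.add_apply, add_mul, Finset.sum_add_distrib, hx, hy, add_zero]
    | smul a x _ hx =>
      simp only [Pi.smul_apply, smul_eq_mul, mul_assoc, ← Finset.mul_sum, hx, mul_zero]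

/-- **The Semistability Theorem for a semistable proper `𝔟` in a linear `M_κ` (`γ = ∅`)**:
`𝔟 ∩ exp⁻¹(M_κ(ℚ̄)) ⊆ ker(exp)` (indeed `= 0`), from Baker's theorem: `w ∈ Lie K ⊆ 𝔟` for a
connected algebraic `K` (`exists_tangent_le_of_isEmpty`), and a proper semistable `𝔟` contains no
non-zero algebraic Lie subalgebra (`Semistable.finrank_eq_zero_of_le`).
[cite: BakerWustholz2007, Thm. 6.15, §6.7] [cite: Baker1975, Theorem 2.1] -/
theorem mem_ker_of_semistable_of_isEmpty [IsEmpty γ] (L : PeriodPair) (κM : δ → γ → Kbar)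
    {𝔟 : Submodule ℂ (β ⊕ (γ ⊕ δ) → ℂ)} (hrat : IsKRational Kbar 𝔟) (h𝔟 : 𝔟 ≠ ⊤)
    (hss : Semistable κM 𝔟) {w : β ⊕ (γ ⊕ δ) → ℂ} (hw𝔟 : w ∈ 𝔟) (hw : w ∈ Alg L κM) :
    w ∈ ker L κM := by
  obtain ⟨D, hwD, hD𝔟⟩ := exists_tangent_le_of_isEmpty L κM hrat hw𝔟 hw
  have hbot : D.tangent = ⊥ := Submodule.finrank_eq_zero.mp (hss.finrank_eq_zero_of_le h𝔟 D hD𝔟)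
  rw [hbot, Submodule.mem_bot] at hwD
  rw [hwD]
  exact ⟨fun _ => ⟨0, by simp⟩, 0, 0, fun _ => by simp, fun _ => by simp⟩

end Std

end GaGmE

/-- **Baker–Wüstholz's Semistability Theorem (Thm. 6.15) for the explicit group varieties `M_κ`
without elliptic factor (`γ = ∅`: the linear groups `𝔾ₘ^β × 𝔾ₐ^δ`), proved outright from Baker's
theorem** — the statement of the named fact `semistabilityTheorem_std` with the extra hypothesis
`[IsEmpty γ]` (the hypotheses on `Λ` are then void). [cite: BakerWustholz2007, Thm. 6.15, Thm. 2.1] [cite: Baker1975, Theorem 2.1] -/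
theorem semistabilityTheorem_std_of_isEmpty :
    ∀ (L : PeriodPair), IsAlgebraic ℚ L.g₂ → IsAlgebraic ℚ L.g₃ → ¬ L.HasCM →
      ∀ (β γ δ : Type) [Fintype β] [Fintype γ] [Fintype δ] [IsEmpty γ] (κM : δ → γ → GaGmE.Kbar)
        (𝔟 : Submodule ℂ (β ⊕ (γ ⊕ δ) → ℂ)), LiePresentation.IsKRational GaGmE.Kbar 𝔟 → 𝔟 ≠ ⊤ →
        GaGmE.Std.Semistable κM 𝔟 →
        ∀ w ∈ 𝔟, w ∈ GaGmE.Std.Alg L κM → w ∈ GaGmE.Std.ker L κM :=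
  fun L _ _ _ _ _ _ _ _ _ _ κM _ hrat h𝔟 hss _ hw𝔟 hw =>
    GaGmE.Std.mem_ker_of_semistable_of_isEmpty L κM hrat h𝔟 hss hw𝔟 hw

end Literature.NumberTheory.Transcendental

end
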